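import Summits.KontsevichZagierPeriods.KontsevichZagierPeriods.Theorems.RootDecompRelativeModAbsoluteAngleFoldP4

/-! # `RootDecompRelativeModAbsoluteAngleFoldP5` — part 5/9 of the mechanical ≤400-line split of `af_src.lean` (sha256 2a2742458ba4dd14…)
Source: decomp-kz lens-3 g14 AngleFold.lean @5fd37862 (lint-fixed copy @30e24be4 by writer g8 per critic g6-12): ANGLE ADDITION IN FAMILIES — angleCellwiseFoldAt_one : AngleCellwiseFoldAt 1 PROVED (critic CLEARED g6-12 l.1335); --supports stmt-KontsevichZagierPeriods-30572.
Split by census-1 g10 `gen/splitlean.py`: scopes re-opened with their `open`/`variable`/`set_option` context; mathematics and declaration order unchanged. -/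

noncomputable section
open Set MeasureTheory
open Literature.NumberTheory.Transcendental Literature.ModelTheory.ExponentialFields
namespace Summit.KontsevichZagierPeriods.RootDecompRelativeModAbsolute.Rung30571.RegularisedLogLayer.CylLog.Leaf.G13
open Set MeasureTheory in
open Literature.NumberTheory.Transcendental Literature.ModelTheory.ExponentialFields in
/-- `[r] + [r.neg] ∈ relations`. -/
private theorem of_add_of_neg_mem_relations {n : ℕ} (r : KZ.IntegralRep n) : KZ.of r + KZ.of r.neg ∈ KZ.relations := by
  obtain ⟨Z, hZd, hZi⟩ := KZ.exists_zeroRep r.isSemialgebraic_domain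
  have hZ : KZ.of Z ∈ KZ.relations := KZ.of_mem_relations_of_eqOn_zero Z (fun z _ => by simp [hZi])
  have h1 : KZ.of Z - KZ.of r - KZ.of r.neg ∈ KZ.relations :=
    KZ.integrandAddRel_subset_relations ⟨n, Z, r, r.neg, hZd.symm, by rw [KZ.IntegralRep.domain_neg, hZd],
      fun z _ => by simp [hZi], rfl⟩
  convert KZ.relations.sub_mem hZ h1 using 1
  abel

open Set MeasureTheory in
open Literature.NumberTheory.Transcendental Literature.ModelTheory.ExponentialFields in
/-- Auxiliary step `init_apply_zero` (§B2): init apply zero. [bookkeeping] -/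
private theorem init_apply_zero (z : Fin 2 → ℝ) : Fin.init z 0 = z 0 := rfl

namespace AngleFold

/-- Auxiliary step `dec_piece`: dec piece. [bookkeeping] -/
theorem dec_piece {T : Set (Fin 1 → ℝ)} (hT : IsSemialgebraic ℚ T) (hTo : IsOpen T) (hTc : OrdConv T)
    (hne : T.Nonempty) {p u : (Fin 1 → ℝ) → ℝ} (hp : IsSemialgebraicFunOn ℚ T p) (hu : IsSemialgebraicFunOn ℚ T u)
    (hu0 : ∀ x ∈ T, 0 ≤ u x) (hud : ∀ x ∈ T, DifferentiableAt ℝ u x) (hdu : ∀ x ∈ T, du u x < 0)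
    (A : KZ.IntegralRep 2) (hAd : A.domain = KZlog.band T (fun _ => 0) u)
    (hAi : EqOn A.integrand (fun z => p (Fin.init z) / (1 + z (Fin.last 1) ^ 2)) A.domain)
    (hint : IntegrableOn (fun x => p x * Real.arctan (u x)) T) :
    ∃ (d : ℝ) (K W : KZ.IntegralRep 2), 0 ≤ d ∧ SaConst T d ∧
      K.domain = KZlog.band T (fun _ => 0) (fun _ => d) ∧
      K.integrand = (fun z => p (Fin.init z) / (1 + z (Fin.last 1) ^ 2)) ∧
      W.domain = Rgn T ∧ W.integrand = wfun p u ∧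
      cl A = cl K - cl W ∧
      ∀ δ > 0, ∃ x₁ ∈ T, ∀ x ∈ T, x₁ 0 ≤ x 0 → |Real.arctan (u x) - Real.arctan d| < δ := by
  have hTm : MeasurableSet T := IsSemialgebraic.measurableSet_holds hT
  -- the real parametrisation and monotonicity
  set uR : ℝ → ℝ := fun s => u (bpt s) with huR
  have hderR : ∀ s ∈ bpt ⁻¹' T, HasDerivAt uR (du u (bpt s)) s := fun s hs => hasDerivAt_comp_bpt (hud _ hs)
  have hcontR : ContinuousOn uR (bpt ⁻¹' T) := fun s hs => (hderR s hs).continuousAt.continuousWithinAt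
  have hanti : StrictAntiOn uR (bpt ⁻¹' T) := strictAntiOn_of_du_neg hTo hTc hud hdu
  have hlt_of_lt : ∀ x ∈ T, ∀ y ∈ T, x 0 < y 0 → u y < u x := fun x hx y hy hxy => by
    have := hanti (mem_preimage_bpt hx) (mem_preimage_bpt hy) hxy
    simpa only [huR, bpt_apply_zero] using this
  have hle_of_le : ∀ x ∈ T, ∀ y ∈ T, x 0 ≤ y 0 → u y ≤ u x := fun x hx y hy hxy => by
    have := hanti.antitoneOn (mem_preimage_bpt hx) (mem_preimage_bpt hy) hxy
    simpa only [huR, bpt_apply_zero] using this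
  -- the infimum `d`
  set D : Set ℝ := u '' T with hD
  have hDne : D.Nonempty := hne.image u
  have hDbdd : BddBelow D := ⟨0, by rintro _ ⟨x, hx, rfl⟩; exact hu0 x hx⟩
  set d := sInf D with hd
  have hd0 : 0 ≤ d := le_csInf hDne (by rintro _ ⟨x, hx, rfl⟩; exact hu0 x hx)
  have hdle : ∀ x ∈ T, d ≤ u x := fun x hx => csInf_le hDbdd ⟨x, hx, rfl⟩
  have hdlt : ∀ x ∈ T, d < u x := fun x hx => by
    obtain ⟨y, hy, hxy⟩ := exists_mem_gt hTo hx
    exact (hdle y hy).trans_lt (hlt_of_lt x hx y hy hxy)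
  have happ : ∀ t, d < t → ∃ x ∈ T, u x < t := fun t ht => by
    obtain ⟨_, ⟨x, hx, rfl⟩, hlt⟩ := exists_lt_of_csInf_lt hDne ht
    exact ⟨x, hx, hlt⟩
  have hdalg : IsAlgebraic ℚ d := isAlgebraic_of_order_frontier hT hu hdlt fun ε hε => by
    obtain ⟨x, hx, h⟩ := happ (d + ε) (by linarith)
    exact ⟨x, hx, h⟩
  have hds : SaConst T d := saConst_of_isAlgebraic hT hdalg
  -- the constant monomial `K`
  have harc0 : 0 ≤ Real.arctan d := by
    have := Real.arctan_strictMono.monotone hd0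
    simpa using this
  have hKint : IntegrableOn (fun x => p x * Real.arctan d) T := by
    refine Integrable.mono' hint.norm
      ((KZ.aestronglyMeasurable_of_isSemialgebraicFunOn hp hTm).mul aestronglyMeasurable_const) ?_
    refine (ae_restrict_iff' hTm).2 (Filter.Eventually.of_forall fun x hx => ?_)
    have h1 : Real.arctan d ≤ Real.arctan (u x) := Real.arctan_strictMono.monotone (hdle x hx)
    have h2 : 0 ≤ Real.arctan (u x) := harc0.trans h1
    rw [Real.norm_eq_abs, Real.norm_eq_abs, abs_mul, abs_mul, abs_of_nonneg harc0, abs_of_nonneg h2]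
    exact mul_le_mul_of_nonneg_left h1 (abs_nonneg _)
  let K : KZ.IntegralRep 2 := arctanRep hT hds hp (fun _ _ => hd0) hKint
  have hKd : K.domain = KZlog.band T (fun _ => 0) (fun _ => d) := rfl
  have hKi : K.integrand = fun z => p (Fin.init z) / (1 + z (Fin.last 1) ^ 2) := rfl
  -- the substitution data on `Rgn T`
  set ψ : (Fin 2 → ℝ) → ℝ := fun z => u (bpt (z (Fin.last 1))) with hψ
  set ψs : (Fin 2 → ℝ) → ℝ := fun z => du u (bpt (z (Fin.last 1))) with hψs
  have hRsa : IsSemialgebraic ℚ (Rgn T) := isSemialgebraic_Rgn hT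
  have hRm : MeasurableSet (Rgn T) := IsSemialgebraic.measurableSet_holds hRsa
  have hR2 : Rgn T ⊆ {z | bpt (z (Fin.last 1)) ∈ T} := fun z hz => hz.2.1
  have hψsa : IsSemialgebraicFunOn ℚ (Rgn T) ψ := (sa_comp_bpt hu (Fin.last 1)).mono hR2 hRsa
  have hψd : ∀ z ∈ Rgn T, DifferentiableAt ℝ ψ z := fun z hz => by
    have h1 : DifferentiableAt ℝ (fun z : Fin 2 → ℝ => bpt (z (Fin.last 1))) z :=
      differentiableAt_pi.2 fun _ => differentiableAt_apply (Fin.last 1) z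
    exact (hud _ hz.2.1).comp z h1
  have hψs' : ∀ z ∈ Rgn T, HasDerivAt (fun t : ℝ => ψ (Fin.snoc (Fin.init z) t)) (ψs z) (z (Fin.last 1)) :=
    fun z hz => by
    have hfun : (fun t : ℝ => ψ (Fin.snoc (Fin.init z) t)) = uR := by
      funext t; simp only [hψ, huR, Fin.snoc_last]
    rw [hfun]
    exact hderR _ hz.2.1
  have hinj : ∀ z₁ ∈ Rgn T, ∀ z₂ ∈ Rgn T, Fin.init z₁ = Fin.init z₂ → ψ z₁ = ψ z₂ →
      z₁ (Fin.last 1) = z₂ (Fin.last 1) := fun z₁ h₁ z₂ h₂ _ he => hanti.injOn h₁.2.1 h₂.2.1 he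
  -- the image `P`
  set P : Set (Fin 2 → ℝ) := {w | Fin.init w ∈ T ∧ d < w (Fin.last 1) ∧ w (Fin.last 1) < u (Fin.init w)} with hP
  have himage : substMap ψ '' Rgn T = P := by
    ext w
    constructor
    · rintro ⟨z, hz, rfl⟩
      refine ⟨by rw [init_substMap]; exact hz.1, by rw [substMap_last]; exact hdlt _ hz.2.1, ?_⟩
      rw [substMap_last, init_substMap]
      have h := hlt_of_lt (Fin.init z) hz.1 (bpt (z (Fin.last 1))) hz.2.1
        (by rw [init_apply_zero, bpt_apply]; exact hz.2.2)
      exact h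
    · rintro ⟨hx, hdt, htu⟩
      obtain ⟨y, hy, hyt⟩ := happ _ hdt
      have hxy : Fin.init w 0 < y 0 := by
        by_contra hle
        push Not at hle
        have := hle_of_le y hy (Fin.init w) hx hle
        linarith
      have hIcc : Icc (Fin.init w 0) (y 0) ⊆ bpt ⁻¹' T := fun s hs => hTc _ hx _ hy s hs.1 hs.2
      have hivt := intermediate_value_Ioo' hxy.le (hcontR.mono hIcc)
      have ht : w (Fin.last 1) ∈ Ioo (uR (y 0)) (uR (Fin.init w 0)) := by
        simp only [huR, bpt_apply_zero]; exact ⟨hyt, htu⟩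
      obtain ⟨ξ, hξ, hξt⟩ := hivt ht
      have hξT : bpt ξ ∈ T := hIcc (Ioo_subset_Icc_self hξ)
      have h0 : (Fin.snoc (Fin.init w) ξ : Fin 2 → ℝ) 0 = Fin.init w 0 := by
        rw [show (0 : Fin 2) = Fin.castSucc (0 : Fin 1) from rfl, Fin.snoc_castSucc]
      refine ⟨Fin.snoc (Fin.init w) ξ, ⟨by rw [Fin.init_snoc]; exact hx, by rw [Fin.snoc_last]; exact hξT,
        by rw [Fin.snoc_last, h0]; exact hξ.1⟩, ?_⟩
      rw [substMap_apply, Fin.init_snoc]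
      simp only [hψ, Fin.snoc_last]
      rw [show u (bpt ξ) = w (Fin.last 1) from hξt, Fin.snoc_init_self]
  -- the piece `Prep = A ∣ P`
  have hPA : P ⊆ A.domain := fun w hw => by
    rw [hAd]; exact ⟨hw.1, hd0.trans hw.2.1.le, hw.2.2.le⟩
  have hB : IsSemialgebraic ℚ {w : Fin 2 → ℝ | Fin.init w ∈ T} := isSemialgebraic_initMem hT
  have hPsa : IsSemialgebraic ℚ P := by
    have hc : IsSemialgebraicFunOn ℚ {w : Fin 2 → ℝ | Fin.init w ∈ T} (fun _ => d) := saConst_of_isAlgebraic hB hdalg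
    have hl : IsSemialgebraicFunOn ℚ {w : Fin 2 → ℝ | Fin.init w ∈ T} (fun w => w (Fin.last 1)) :=
      Literature.NumberTheory.Transcendental.isSemialgebraicFunOn_apply hB (Fin.last 1)
    have hs1 : IsSemialgebraicFunOn ℚ {w : Fin 2 → ℝ | Fin.init w ∈ T} (fun w => d - w (Fin.last 1)) :=
      IsSemialgebraicFunOn.sub_holds hc hl
    have hs2 : IsSemialgebraicFunOn ℚ {w : Fin 2 → ℝ | Fin.init w ∈ T} (fun w => w (Fin.last 1) - u (Fin.init w)) :=
      IsSemialgebraicFunOn.sub_holds hl hu.comp_init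
    have h1 := hs1.isSemialgebraic_sep_neg
    have h2 := hs2.isSemialgebraic_sep_neg
    have hPeq : P = {w | w ∈ {w : Fin 2 → ℝ | Fin.init w ∈ T} ∧ (fun w => d - w (Fin.last 1)) w < 0} ∩
        {w | w ∈ {w : Fin 2 → ℝ | Fin.init w ∈ T} ∧ (fun w => w (Fin.last 1) - u (Fin.init w)) w < 0} := by
      ext w
      simp only [hP, mem_setOf_eq, mem_inter_iff]
      constructor
      · rintro ⟨hx, h1, h2⟩; exact ⟨⟨hx, by linarith⟩, ⟨hx, by linarith⟩⟩
      · rintro ⟨⟨hx, h1⟩, ⟨_, h2⟩⟩; exact ⟨hx, by linarith, by linarith⟩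
    rw [hPeq]
    exact h1.inter h2
  have hPm : MeasurableSet P := IsSemialgebraic.measurableSet_holds hPsa
  set g : (Fin 2 → ℝ) → ℝ := fun w => p (Fin.init w) / (1 + w (Fin.last 1) ^ 2) with hg
  have hgsa : IsSemialgebraicFunOn ℚ P g := sa_kernel hPsa (fun w hw => hw.1) hp
  have hgint : IntegrableOn g P := (A.integrableOn.mono_set hPA).congr_fun (hAi.mono hPA) hPm
  let Prep : KZ.IntegralRep 2 := ⟨P, g, hPsa, hgsa, hgint⟩
  -- the Jacobian monomial `W` on `Rgn T`
  have hwint : IntegrableOn (wfun p u) (Rgn T) := by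
    have h1 : IntegrableOn g (substMap ψ '' Rgn T) := by rw [himage]; exact hgint
    rw [integrableOn_image_substMap_iff hRm ψ ψs hψd hψs' hinj g] at h1
    refine (h1.neg).congr_fun (fun z hz => ?_) hRm
    simp only [hψs, hg, init_substMap, substMap_last, hψ, wfun, Pi.neg_apply]
    rw [abs_of_neg (hdu _ hz.2.1)]
    ring
  have hwsa : IsSemialgebraicFunOn ℚ (Rgn T) (wfun p u) := sa_wfun hT hTo hp hu hud
  let W : KZ.IntegralRep 2 := ⟨Rgn T, wfun p u, hRsa, hwsa, hwint⟩
  -- the relations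
  have r1 : KZ.of W.neg - KZ.of Prep ∈ KZ.relations := by
    refine of_sub_of_mem_relations_of_subst ψ ψs W.neg Prep hψsa hψd hψs' hinj himage.symm fun z hz => ?_
    show -wfun p u z = g (substMap ψ z) * |ψs z|
    simp only [hg, hψs, hψ, wfun, init_substMap, substMap_last]
    rw [abs_of_neg (hdu _ hz.2.1)]
    ring
  have hKA : K.domain ⊆ A.domain := fun w hw => by
    rw [hAd]; exact ⟨hw.1, hw.2.1, hw.2.2.trans (hdle _ hw.1)⟩
  have hSsa : IsSemialgebraic ℚ (K.domain ∪ P) := K.isSemialgebraic_domain.union hPsa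
  have hSA : K.domain ∪ P ⊆ A.domain := union_subset hKA hPA
  have hvol : volume (A.domain \ (K.domain ∪ P)) = 0 := by
    refine measure_mono_null (fun w hw => ?_) (KZ.volume_graph_eq_zero hu)
    obtain ⟨hw, hnot⟩ := hw
    rw [hAd] at hw
    obtain ⟨hx, h0, hle⟩ := hw
    simp only [mem_union, not_or] at hnot
    refine ⟨hx, le_antisymm hle ?_⟩
    by_contra hlt
    push Not at hlt
    by_cases hdt : w (Fin.last 1) ≤ d
    · exact hnot.1 ⟨hx, h0, hdt⟩
    · exact hnot.2 ⟨hx, lt_of_not_ge hdt, hlt⟩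
  have r2 : KZ.of A - KZ.of (A.restrict _ hSsa hSA) ∈ KZ.relations :=
    A.of_sub_of_restrict_mem_relations hSsa hSA hvol
  have r3 : KZ.of (A.restrict _ hSsa hSA) - KZ.of K - KZ.of Prep ∈ KZ.relations := by
    refine KZ.domainAddRel_subset_relations ⟨2, A.restrict _ hSsa hSA, K, Prep, rfl, ?_, ?_, ?_, rfl⟩
    · have : K.domain ∩ P = ∅ := by
        ext w
        simp only [mem_inter_iff, mem_empty_iff_false, iff_false, not_and]
        intro hK hPw
        exact absurd hPw.2.1 (not_lt.2 hK.2.2)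
      show volume (K.domain ∩ P) = 0
      rw [this]; exact measure_empty
    · exact fun w hw => hAi (hKA hw)
    · exact fun w hw => hAi (hPA hw)
  have r4 := of_add_of_neg_mem_relations W
  -- in the quotient
  have e1 : cl A = cl (A.restrict _ hSsa hSA) := mk_sub_eq r2
  have e2 : cl (A.restrict _ hSsa hSA) = cl K + cl Prep := by
    rw [sub_sub] at r3
    have := mk_sub_eq r3
    rwa [map_add] at this
  have e3 : cl W.neg = cl Prep := mk_sub_eq r1
  have e4 : cl W + cl W.neg = 0 := by
    show mk _ + mk _ = 0
    rw [← map_add, mk_eq_zero_iff]; exact r4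
  refine ⟨d, K, W, hd0, hds, hKd, hKi, rfl, rfl, ?_, ?_⟩
  · calc cl A = cl (A.restrict _ hSsa hSA) := e1
      _ = cl K + cl Prep := e2
      _ = cl K + cl W.neg := by rw [e3]
      _ = cl K - cl W := by rw [eq_neg_of_add_eq_zero_right e4, ← sub_eq_add_neg]
  · intro δ hδ
    obtain ⟨η, hη, hcont⟩ := Metric.continuousAt_iff.1 (Real.continuous_arctan.continuousAt (x := d)) δ hδ
    obtain ⟨x₁, hx₁, hux₁⟩ := happ (d + η) (by linarith)
    refine ⟨x₁, hx₁, fun x hx hle => ?_⟩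
    have h1 := hle_of_le x₁ hx₁ x hx hle
    have h2 := hdlt x hx
    have h3 : dist (u x) d < η := by
      rw [Real.dist_eq, abs_of_pos (by linarith)]; linarith
    have := hcont h3
    rwa [Real.dist_eq] at this

/-! ### §B4 An edge strictly INCREASING towards the top end: reciprocity `[u] + [1/u] = 2[1]` (tree) and the
substitution core for the decreasing edge `1/u`. -/

/-- Auxiliary step `abs_arctan_le` (§B4): abs arctan le. [bookkeeping] -/
theorem abs_arctan_le (t : ℝ) : |Real.arctan t| ≤ Real.pi / 2 :=
  abs_le.2 ⟨(Real.neg_pi_div_two_lt_arctan t).le, (Real.arctan_lt_pi_div_two t).le⟩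

/-- Auxiliary step `differentiableAt_init` (§B4): differentiable At init. [bookkeeping] -/
theorem differentiableAt_init (z : Fin 2 → ℝ) : DifferentiableAt ℝ (Fin.init : (Fin 2 → ℝ) → Fin 1 → ℝ) z :=
  differentiableAt_pi.2 fun i => differentiableAt_apply (Fin.castSucc i) z

end AngleFold
end Summit.KontsevichZagierPeriods.RootDecompRelativeModAbsolute.Rung30571.RegularisedLogLayer.CylLog.Leaf.G13
end
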